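import Mathlib
import Summits.NavierStokesRegularity.NavierStokesRegularity.Theorems.EulerZoomLiouvillePowerGaugeEulerLiouvilleCondenserConvectivePolar

/-!
# (I) THE SLICE RADIAL-MOMENTUM IDENTITY — plate t50-I of nsreg-p2 ROUND-47 «WHO HOLDS THE RIDGE»
(`r47/Sketch47.lean` sha16 fea44084dd39e0a7 (v1.1; the Prop is byte-identical to v1.0 c5b0bf755040b563), text VERBATIM)

Width piece for crux `EulerZoomLiouville.PowerGaugeEulerLiouville` (stmt-NavierStokesRegularity-19832), by name under
LEAD 19832 (ns-typeII-p2 g14) and planner nsreg-p2 g37; seat ns-ezl-w2 g5,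
`--supports stmt-NavierStokesRegularity-19832 --as helper`.

2-D slice data `p : ℂ → ℝ` (pressure), `v : ℂ → ℂ` (transverse velocity), `w : ℂ → ℝ` (axial drift), `a : ℂ → ℂ` (the ROW
`∂_eV_⊥`), `b : ℂ → ℝ` (the DIAGONAL `∂_eV_e`), `γ`, `ζ₀ : ℂ`, tied by the slice equations
`∇p = −(1−γ)v − Dv[γ(z+ζ₀) + v] − w·a`, `div v = −b`.  Then for `0 < δ ≤ d` (polar frame `r̂ = e^{iθ}`, `θ̂ = ie^{iθ}`):
`⨍_{S_δ}(p + v_r²) − ⨍_{S_d}(p + v_r²) = (1−2γ)(2π)⁻¹∫∫ v_r + γ(d⨍_{S_d}v_r − δ⨍_{S_δ}v_r) + (2π)⁻¹∫∫ w⟪a,r̂⟫`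
`   + γ(2π)⁻¹∫∫⟪Dv[ζ₀], r̂⟫ + (2π)⁻¹∫∫ v_r b + (2π)⁻¹∫ ρ⁻¹∫ (v_r² − v_θ²)`   (`∫∫ = ∫_δ^d ∫_0^{2π} … dθ dρ`).
Proof: `⨍_{S_d}p − ⨍_{S_δ}p = ∫_δ^d m_p′` (tree `integral_circleAverage_radialDeriv`) with
`Dp[r̂] = −(1−γ)v_r − γρ∂_ρv_r − γ⟪Dv[ζ₀],r̂⟫ − ⟪Dv[v],r̂⟫ − w⟪a,r̂⟫` (`⟪Dv[z], r̂⟫ = ρ∂_ρv_r` at `z = ρr̂`); the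
`ρ∂_ρv_r` term is integrated by parts in `ρ` (Fubini `MeasureTheory.intervalIntegral_intervalIntegral_swap` twice), the
convective term is (Ib) `Condenser.convectivePolarIdentity_of`.  NO COLUMN ENTRY `∇_⊥V_e` OCCURS.

* `sliceRadialMomentumIdentity_of` (working form), `sliceRadialMomentumIdentity` = `NsregP2.R47.SliceRadialMomentumIdentity`.

HONEST FRAMING: plane calculus; proves nothing about the crux E (19832 OPEN), any door Target, THEOREM K⁗, or
Navier–Stokes regularity; no summit statement is touched. [folklore]
-/

noncomputable section

open Set Filter Topology Metric Function MeasureTheory Complex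
open scoped Real RealInnerProductSpace

set_option linter.dupNamespace false

namespace Summit.NavierStokesRegularity.NavierStokesRegularity.Theorems.PowerGaugeEulerLiouville.Condenser

/-- The circle average of `⟪v z, ‖z‖⁻¹z⟫` on `‖z‖ = ρ > 0` is `(2π)⁻¹ ∫_0^{2π} v_r(ρe^{iθ}) dθ`. [folklore] -/
theorem circleAverage_inner_unit {v : ℂ → ℂ} {ρ : ℝ} (hρ : 0 < ρ) :
    Real.circleAverage (fun z : ℂ => ⟪v z, (‖z‖⁻¹ : ℝ) • z⟫) 0 ρ =
      (2 * π)⁻¹ * ∫ θ in (0 : ℝ)..2 * π, ⟪v (circleMap 0 ρ θ), circleMap 0 1 θ⟫ := by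
  rw [Real.circleAverage_def, smul_eq_mul]
  congr 1
  exact intervalIntegral.integral_congr fun θ _ => by simp only [inv_norm_smul_circleMap hρ θ]

/-- **The `ρ∂_ρv_r` term integrated by parts in the radius** (Fubini twice + 1-D integration by parts): for
`v ∈ C¹` and `δ ≤ d`,
`∫_δ^d ρ ∫_0^{2π} ⟪Dv(ρe^{iθ})[e^{iθ}], e^{iθ}⟫ dθ dρ = d∫_0^{2π} v_r(d,θ)dθ − δ∫_0^{2π} v_r(δ,θ)dθ − ∫_δ^d∫_0^{2π} v_r`.
[folklore] -/
theorem integral_mul_integral_radialDeriv_inner {v : ℂ → ℂ} (hv : ContDiff ℝ 1 v) {δ d : ℝ} (hδd : δ ≤ d) :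
    ∫ ρ in δ..d, ρ * ∫ θ in (0 : ℝ)..2 * π,
        ⟪fderiv ℝ v (circleMap 0 ρ θ) (circleMap 0 1 θ), circleMap 0 1 θ⟫ =
      d * (∫ θ in (0 : ℝ)..2 * π, ⟪v (circleMap 0 d θ), circleMap 0 1 θ⟫) -
        δ * (∫ θ in (0 : ℝ)..2 * π, ⟪v (circleMap 0 δ θ), circleMap 0 1 θ⟫) -
        ∫ ρ in δ..d, ∫ θ in (0 : ℝ)..2 * π, ⟪v (circleMap 0 ρ θ), circleMap 0 1 θ⟫ := by
  have hvd : Differentiable ℝ v := hv.differentiable one_ne_zero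
  obtain ⟨hc1, -⟩ := continuous_circleMap_one_frame
  have h2π : (0 : ℝ) ≤ 2 * π := by positivity
  have hK : IsCompact (Icc δ d ×ˢ Icc (0 : ℝ) (2 * π)) := isCompact_Icc.prod isCompact_Icc
  have hsub : uIoc δ d ×ˢ uIoc 0 (2 * π) ⊆ Icc δ d ×ˢ Icc (0 : ℝ) (2 * π) := by
    rw [uIoc_of_le hδd, uIoc_of_le h2π]; exact Set.prod_mono Ioc_subset_Icc_self Ioc_subset_Icc_self
  -- joint continuity
  have hF : Continuous fun q : ℝ × ℝ => q.1 * ⟪fderiv ℝ v (circleMap 0 q.1 q.2) (circleMap 0 1 q.2),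
      circleMap 0 1 q.2⟫ := continuous_fst.mul (continuous_inner_fderiv_polar hv hc1 hc1)
  have hG : Continuous fun q : ℝ × ℝ => ⟪v (circleMap 0 q.1 q.2), circleMap 0 1 q.2⟫ :=
    continuous_inner_comp_polar hv.continuous hc1
  -- move `ρ` inside and swap
  have h1 : ∫ ρ in δ..d, ρ * ∫ θ in (0 : ℝ)..2 * π,
      ⟪fderiv ℝ v (circleMap 0 ρ θ) (circleMap 0 1 θ), circleMap 0 1 θ⟫ =
      ∫ ρ in δ..d, ∫ θ in (0 : ℝ)..2 * π,
        ρ * ⟪fderiv ℝ v (circleMap 0 ρ θ) (circleMap 0 1 θ), circleMap 0 1 θ⟫ :=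
    intervalIntegral.integral_congr fun ρ _ => (intervalIntegral.integral_const_mul _ _).symm
  have hswap : ∫ ρ in δ..d, ∫ θ in (0 : ℝ)..2 * π,
      ρ * ⟪fderiv ℝ v (circleMap 0 ρ θ) (circleMap 0 1 θ), circleMap 0 1 θ⟫ =
      ∫ θ in (0 : ℝ)..2 * π, ∫ ρ in δ..d,
        ρ * ⟪fderiv ℝ v (circleMap 0 ρ θ) (circleMap 0 1 θ), circleMap 0 1 θ⟫ := by
    refine MeasureTheory.intervalIntegral_intervalIntegral_swap ?_
    exact (hF.continuousOn.integrableOn_compact hK).mono_set hsub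
  have hswap' : ∫ ρ in δ..d, ∫ θ in (0 : ℝ)..2 * π, ⟪v (circleMap 0 ρ θ), circleMap 0 1 θ⟫ =
      ∫ θ in (0 : ℝ)..2 * π, ∫ ρ in δ..d, ⟪v (circleMap 0 ρ θ), circleMap 0 1 θ⟫ := by
    refine MeasureTheory.intervalIntegral_intervalIntegral_swap ?_
    exact (hG.continuousOn.integrableOn_compact hK).mono_set hsub
  rw [h1, hswap, hswap']
  -- 1-D integration by parts in `ρ` at fixed `θ`
  have hIBP : ∀ θ : ℝ, ∫ ρ in δ..d, ρ * ⟪fderiv ℝ v (circleMap 0 ρ θ) (circleMap 0 1 θ), circleMap 0 1 θ⟫ =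
      d * ⟪v (circleMap 0 d θ), circleMap 0 1 θ⟫ - δ * ⟪v (circleMap 0 δ θ), circleMap 0 1 θ⟫ -
        ∫ ρ in δ..d, ⟪v (circleMap 0 ρ θ), circleMap 0 1 θ⟫ := by
    intro θ
    have hρc : Continuous fun ρ : ℝ => circleMap 0 ρ θ := by unfold circleMap; fun_prop
    have hvrc : Continuous fun ρ : ℝ => ⟪v (circleMap 0 ρ θ), circleMap 0 1 θ⟫ :=
      (hv.continuous.comp hρc).inner continuous_const
    have hDc : Continuous fun ρ : ℝ => ⟪fderiv ℝ v (circleMap 0 ρ θ) (circleMap 0 1 θ), circleMap 0 1 θ⟫ :=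
      (((hv.continuous_fderiv one_ne_zero).comp hρc).clm_apply continuous_const).inner continuous_const
    have h := intervalIntegral.integral_mul_deriv_eq_deriv_mul (a := δ) (b := d) (u := fun ρ : ℝ => ρ)
      (u' := fun _ => (1 : ℝ)) (fun ρ _ => hasDerivAt_id ρ) (fun ρ _ => hasDerivAt_inner_radial_radius hvd θ ρ)
      intervalIntegrable_const (hDc.intervalIntegrable _ _)
    rw [h]
    simp only [one_mul]
  rw [intervalIntegral.integral_congr fun θ _ => hIBP θ]
  have hi1 : IntervalIntegrable (fun θ : ℝ => d * ⟪v (circleMap 0 d θ), circleMap 0 1 θ⟫) volume 0 (2 * π) :=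
    (((hv.continuous.comp (continuous_circleMap 0 d)).inner hc1).const_mul d).intervalIntegrable _ _
  have hi2 : IntervalIntegrable (fun θ : ℝ => δ * ⟪v (circleMap 0 δ θ), circleMap 0 1 θ⟫) volume 0 (2 * π) :=
    (((hv.continuous.comp (continuous_circleMap 0 δ)).inner hc1).const_mul δ).intervalIntegrable _ _
  have hi3 : IntervalIntegrable (fun θ : ℝ => ∫ ρ in δ..d, ⟪v (circleMap 0 ρ θ), circleMap 0 1 θ⟫)
      volume 0 (2 * π) := by
    have hcm' : Continuous fun q : ℝ × ℝ => circleMap 0 q.2 q.1 := by unfold circleMap; fun_prop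
    have hG' : Continuous fun q : ℝ × ℝ => ⟪v (circleMap 0 q.2 q.1), circleMap 0 1 q.1⟫ :=
      (hv.continuous.comp hcm').inner (hc1.comp continuous_fst)
    have hc : Continuous fun θ : ℝ => ∫ ρ in δ..d, ⟪v (circleMap 0 ρ θ), circleMap 0 1 θ⟫ :=
      intervalIntegral.continuous_parametric_intervalIntegral_of_continuous'
        (f := fun θ ρ : ℝ => ⟪v (circleMap 0 ρ θ), circleMap 0 1 θ⟫) hG' δ d
    exact hc.intervalIntegrable _ _
  rw [intervalIntegral.integral_sub (hi1.sub hi2) hi3, intervalIntegral.integral_sub hi1 hi2,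
    intervalIntegral.integral_const_mul, intervalIntegral.integral_const_mul]

/-- **(I) THE SLICE RADIAL-MOMENTUM IDENTITY**, working form.  See the module docstring. [folklore] -/
theorem sliceRadialMomentumIdentity_of {p : ℂ → ℝ} {v a : ℂ → ℂ} {w b : ℂ → ℝ} {γ : ℝ} {ζ₀ : ℂ}
    (hp : ContDiff ℝ 1 p) (hv : ContDiff ℝ 1 v) (ha : Continuous a) (hw : Continuous w) (hb : Continuous b)
    (hpeq : ∀ z h : ℂ, fderiv ℝ p z h =
      ⟪-((1 - γ) • v z) - fderiv ℝ v z (γ • (z + ζ₀) + v z) - w z • a z, h⟫)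
    (hdiv : ∀ z : ℂ, (fderiv ℝ v z 1).re + (fderiv ℝ v z I).im = -b z) {δ d : ℝ} (hδ : 0 < δ) (hδd : δ ≤ d) :
    (Real.circleAverage p 0 δ + Real.circleAverage (fun z : ℂ => ⟪v z, (‖z‖⁻¹ : ℝ) • z⟫ ^ 2) 0 δ) -
        (Real.circleAverage p 0 d + Real.circleAverage (fun z : ℂ => ⟪v z, (‖z‖⁻¹ : ℝ) • z⟫ ^ 2) 0 d) =
      (1 - 2 * γ) * ((2 * Real.pi)⁻¹ * (∫ ρ in δ..d, ∫ θ in (0 : ℝ)..2 * Real.pi,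
          ⟪v (circleMap 0 ρ θ), circleMap 0 1 θ⟫)) +
        γ * (d * Real.circleAverage (fun z : ℂ => ⟪v z, (‖z‖⁻¹ : ℝ) • z⟫) 0 d -
            δ * Real.circleAverage (fun z : ℂ => ⟪v z, (‖z‖⁻¹ : ℝ) • z⟫) 0 δ) +
        (2 * Real.pi)⁻¹ * (∫ ρ in δ..d, ∫ θ in (0 : ℝ)..2 * Real.pi,
          w (circleMap 0 ρ θ) * ⟪a (circleMap 0 ρ θ), circleMap 0 1 θ⟫) +
        γ * ((2 * Real.pi)⁻¹ * (∫ ρ in δ..d, ∫ θ in (0 : ℝ)..2 * Real.pi,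
          ⟪fderiv ℝ v (circleMap 0 ρ θ) ζ₀, circleMap 0 1 θ⟫)) +
        (2 * Real.pi)⁻¹ * (∫ ρ in δ..d, ∫ θ in (0 : ℝ)..2 * Real.pi,
          ⟪v (circleMap 0 ρ θ), circleMap 0 1 θ⟫ * b (circleMap 0 ρ θ)) +
        (2 * Real.pi)⁻¹ * (∫ ρ in δ..d, ρ⁻¹ * ∫ θ in (0 : ℝ)..2 * Real.pi,
          (⟪v (circleMap 0 ρ θ), circleMap 0 1 θ⟫ ^ 2 -
            ⟪v (circleMap 0 ρ θ), circleMap 0 1 θ * I⟫ ^ 2)) := by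
  have hd : 0 < d := hδ.trans_le hδd
  obtain ⟨hc1, hcI⟩ := continuous_circleMap_one_frame
  have hcm2 : Continuous fun q : ℝ × ℝ => circleMap 0 q.1 q.2 := by unfold circleMap; fun_prop
  -- the five radial integrands (functions of `ρ`)
  set X : ℝ → ℝ := fun ρ => ∫ θ in (0 : ℝ)..2 * π, ⟪v (circleMap 0 ρ θ), circleMap 0 1 θ⟫ with hX
  set R : ℝ → ℝ := fun ρ => ∫ θ in (0 : ℝ)..2 * π,
    ⟪fderiv ℝ v (circleMap 0 ρ θ) (circleMap 0 1 θ), circleMap 0 1 θ⟫ with hR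
  set Z : ℝ → ℝ := fun ρ => ∫ θ in (0 : ℝ)..2 * π, ⟪fderiv ℝ v (circleMap 0 ρ θ) ζ₀, circleMap 0 1 θ⟫ with hZ
  set K : ℝ → ℝ := fun ρ => ∫ θ in (0 : ℝ)..2 * π,
    ⟪fderiv ℝ v (circleMap 0 ρ θ) (v (circleMap 0 ρ θ)), circleMap 0 1 θ⟫ with hK
  set W : ℝ → ℝ := fun ρ => ∫ θ in (0 : ℝ)..2 * π, w (circleMap 0 ρ θ) * ⟪a (circleMap 0 ρ θ), circleMap 0 1 θ⟫
    with hW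
  -- joint continuity of the integrands and continuity of the radial functions
  have hFX : Continuous fun q : ℝ × ℝ => ⟪v (circleMap 0 q.1 q.2), circleMap 0 1 q.2⟫ :=
    continuous_inner_comp_polar hv.continuous hc1
  have hFR : Continuous fun q : ℝ × ℝ => ⟪fderiv ℝ v (circleMap 0 q.1 q.2) (circleMap 0 1 q.2),
      circleMap 0 1 q.2⟫ := continuous_inner_fderiv_polar hv hc1 hc1
  have hFZ : Continuous fun q : ℝ × ℝ => ⟪fderiv ℝ v (circleMap 0 q.1 q.2) ζ₀, circleMap 0 1 q.2⟫ :=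
    continuous_inner_fderiv_polar hv continuous_const hc1
  have hFK : Continuous fun q : ℝ × ℝ => ⟪fderiv ℝ v (circleMap 0 q.1 q.2) (v (circleMap 0 q.1 q.2)),
      circleMap 0 1 q.2⟫ :=
    (((hv.continuous_fderiv one_ne_zero).comp hcm2).clm_apply (hv.continuous.comp hcm2)).inner
      (hc1.comp continuous_snd)
  have hFW : Continuous fun q : ℝ × ℝ => w (circleMap 0 q.1 q.2) * ⟪a (circleMap 0 q.1 q.2), circleMap 0 1 q.2⟫ :=
    (hw.comp hcm2).mul ((ha.comp hcm2).inner (hc1.comp continuous_snd))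
  have hXc : Continuous X := intervalIntegral.continuous_parametric_intervalIntegral_of_continuous' hFX _ _
  have hRc : Continuous R := intervalIntegral.continuous_parametric_intervalIntegral_of_continuous' hFR _ _
  have hZc : Continuous Z := intervalIntegral.continuous_parametric_intervalIntegral_of_continuous' hFZ _ _
  have hKc : Continuous K := intervalIntegral.continuous_parametric_intervalIntegral_of_continuous' hFK _ _
  have hWc : Continuous W := intervalIntegral.continuous_parametric_intervalIntegral_of_continuous' hFW _ _
  -- (1) pointwise: the radial derivative of the pressure from the slice equation
  have hpt : ∀ ρ θ : ℝ, fderiv ℝ p (circleMap 0 ρ θ) (circleMap 0 1 θ) =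
      (γ - 1) * ⟪v (circleMap 0 ρ θ), circleMap 0 1 θ⟫ -
        γ * (ρ * ⟪fderiv ℝ v (circleMap 0 ρ θ) (circleMap 0 1 θ), circleMap 0 1 θ⟫) -
        γ * ⟪fderiv ℝ v (circleMap 0 ρ θ) ζ₀, circleMap 0 1 θ⟫ -
        ⟪fderiv ℝ v (circleMap 0 ρ θ) (v (circleMap 0 ρ θ)), circleMap 0 1 θ⟫ -
        w (circleMap 0 ρ θ) * ⟪a (circleMap 0 ρ θ), circleMap 0 1 θ⟫ := by
    intro ρ θ
    have hz : fderiv ℝ v (circleMap 0 ρ θ) (circleMap 0 ρ θ) =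
        ρ • fderiv ℝ v (circleMap 0 ρ θ) (circleMap 0 1 θ) := by
      conv_lhs => rw [show (circleMap 0 ρ θ : ℂ) = circleMap 0 ρ θ from rfl]
      have e : circleMap 0 ρ θ = ρ • circleMap 0 1 θ := circleMap_eq_smul_circleMap_one ρ θ
      calc fderiv ℝ v (circleMap 0 ρ θ) (circleMap 0 ρ θ)
          = fderiv ℝ v (circleMap 0 ρ θ) (ρ • circleMap 0 1 θ) := by rw [← e]
        _ = ρ • fderiv ℝ v (circleMap 0 ρ θ) (circleMap 0 1 θ) := map_smul _ _ _
    rw [hpeq, smul_add, map_add, map_add, map_smul, map_smul, hz]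
    simp only [inner_sub_left, inner_add_left, inner_neg_left, real_inner_smul_left]
    ring
  -- (2) the angular integral of `Dp[r̂]` at radius `ρ`
  have hθ : ∀ ρ : ℝ, ∫ θ in (0 : ℝ)..2 * π, fderiv ℝ p (circleMap 0 ρ θ) (circleMap 0 1 θ) =
      (γ - 1) * X ρ - γ * (ρ * R ρ) - γ * Z ρ - K ρ - W ρ := by
    intro ρ
    have hcm : Continuous fun θ : ℝ => circleMap 0 ρ θ := continuous_circleMap 0 ρ
    have hD : Continuous fun θ : ℝ => fderiv ℝ v (circleMap 0 ρ θ) :=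
      (hv.continuous_fderiv one_ne_zero).comp hcm
    have iX : IntervalIntegrable (fun θ : ℝ => ⟪v (circleMap 0 ρ θ), circleMap 0 1 θ⟫) volume 0 (2 * π) :=
      ((hv.continuous.comp hcm).inner hc1).intervalIntegrable _ _
    have iR : IntervalIntegrable (fun θ : ℝ =>
        ⟪fderiv ℝ v (circleMap 0 ρ θ) (circleMap 0 1 θ), circleMap 0 1 θ⟫) volume 0 (2 * π) :=
      ((hD.clm_apply hc1).inner hc1).intervalIntegrable _ _
    have iZ : IntervalIntegrable (fun θ : ℝ => ⟪fderiv ℝ v (circleMap 0 ρ θ) ζ₀, circleMap 0 1 θ⟫)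
        volume 0 (2 * π) := ((hD.clm_apply continuous_const).inner hc1).intervalIntegrable _ _
    have iK : IntervalIntegrable (fun θ : ℝ =>
        ⟪fderiv ℝ v (circleMap 0 ρ θ) (v (circleMap 0 ρ θ)), circleMap 0 1 θ⟫) volume 0 (2 * π) :=
      ((hD.clm_apply (hv.continuous.comp hcm)).inner hc1).intervalIntegrable _ _
    have iW : IntervalIntegrable (fun θ : ℝ => w (circleMap 0 ρ θ) * ⟪a (circleMap 0 ρ θ), circleMap 0 1 θ⟫)
        volume 0 (2 * π) := ((hw.comp hcm).mul ((ha.comp hcm).inner hc1)).intervalIntegrable _ _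
    rw [intervalIntegral.integral_congr fun θ _ => hpt ρ θ,
      intervalIntegral.integral_sub ((((iX.const_mul _).sub ((iR.const_mul _).const_mul _)).sub
        (iZ.const_mul _)).sub iK) iW,
      intervalIntegral.integral_sub (((iX.const_mul _).sub ((iR.const_mul _).const_mul _)).sub
        (iZ.const_mul _)) iK,
      intervalIntegral.integral_sub ((iX.const_mul _).sub ((iR.const_mul _).const_mul _)) (iZ.const_mul _),
      intervalIntegral.integral_sub (iX.const_mul _) ((iR.const_mul _).const_mul _),
      intervalIntegral.integral_const_mul, intervalIntegral.integral_const_mul,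
      intervalIntegral.integral_const_mul, intervalIntegral.integral_const_mul]
  -- (3) the pressure difference as a radial integral
  have hP0 := integral_circleAverage_radialDeriv hp δ d
  have hP1 : ∫ ρ in δ..d, (2 * π)⁻¹ * ∫ θ in (0 : ℝ)..2 * π, fderiv ℝ p (circleMap 0 ρ θ) (circleMap 0 1 θ) =
      (2 * π)⁻¹ * ∫ ρ in δ..d, ((γ - 1) * X ρ - γ * (ρ * R ρ) - γ * Z ρ - K ρ - W ρ) := by
    rw [← intervalIntegral.integral_const_mul]
    exact intervalIntegral.integral_congr fun ρ _ => by simp only [hθ ρ]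
  have hP : Real.circleAverage p 0 δ - Real.circleAverage p 0 d =
      -((2 * π)⁻¹ * ∫ ρ in δ..d, ((γ - 1) * X ρ - γ * (ρ * R ρ) - γ * Z ρ - K ρ - W ρ)) := by
    rw [← hP1, hP0]; ring
  have hsplit : ∫ ρ in δ..d, ((γ - 1) * X ρ - γ * (ρ * R ρ) - γ * Z ρ - K ρ - W ρ) =
      (γ - 1) * (∫ ρ in δ..d, X ρ) - γ * (∫ ρ in δ..d, ρ * R ρ) - γ * (∫ ρ in δ..d, Z ρ) -
        (∫ ρ in δ..d, K ρ) - ∫ ρ in δ..d, W ρ := by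
    have iX : IntervalIntegrable X volume δ d := hXc.intervalIntegrable δ d
    have iR : IntervalIntegrable (fun ρ => ρ * R ρ) volume δ d := (continuous_id.mul hRc).intervalIntegrable δ d
    have iZ : IntervalIntegrable Z volume δ d := hZc.intervalIntegrable δ d
    have iK : IntervalIntegrable K volume δ d := hKc.intervalIntegrable δ d
    have iW : IntervalIntegrable W volume δ d := hWc.intervalIntegrable δ d
    rw [intervalIntegral.integral_sub ((((iX.const_mul _).sub (iR.const_mul _)).sub (iZ.const_mul _)).sub iK) iW,
      intervalIntegral.integral_sub (((iX.const_mul _).sub (iR.const_mul _)).sub (iZ.const_mul _)) iK,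
      intervalIntegral.integral_sub ((iX.const_mul _).sub (iR.const_mul _)) (iZ.const_mul _),
      intervalIntegral.integral_sub (iX.const_mul _) (iR.const_mul _),
      intervalIntegral.integral_const_mul, intervalIntegral.integral_const_mul, intervalIntegral.integral_const_mul]
  -- (4) the `ρ∂_ρv_r` term and the convective term
  have hRR : ∫ ρ in δ..d, ρ * R ρ = d * X d - δ * X δ - ∫ ρ in δ..d, X ρ :=
    integral_mul_integral_radialDeriv_inner hv hδd
  have hKK := convectivePolarIdentity_of hv hb hdiv hδ hδd
  -- assemble
  rw [show (Real.circleAverage p 0 δ + Real.circleAverage (fun z : ℂ => ⟪v z, (‖z‖⁻¹ : ℝ) • z⟫ ^ 2) 0 δ) -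
      (Real.circleAverage p 0 d + Real.circleAverage (fun z : ℂ => ⟪v z, (‖z‖⁻¹ : ℝ) • z⟫ ^ 2) 0 d) =
      (Real.circleAverage p 0 δ - Real.circleAverage p 0 d) -
        (Real.circleAverage (fun z : ℂ => ⟪v z, (‖z‖⁻¹ : ℝ) • z⟫ ^ 2) 0 d -
          Real.circleAverage (fun z : ℂ => ⟪v z, (‖z‖⁻¹ : ℝ) • z⟫ ^ 2) 0 δ) by ring,
    hP, hsplit, hRR, circleAverage_inner_unit hd, circleAverage_inner_unit hδ]
  simp only [hX, hZ, hK, hW]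
  linear_combination hKK

/-- **(I) `NsregP2.R47.SliceRadialMomentumIdentity`, binder-for-binder** (Sketch47 of nsreg-p2 g37, plate t50-I).
In the assembly of THEOREM K⁗ the data come from (SR) `SliceReduction`; the left side at `δ → 0` is the transverse
payment (M7), the right side is priced term by term by (M2)–(M6) ((H47a) `RidgeHoldingBound`). [folklore] -/
theorem sliceRadialMomentumIdentity :
    ∀ (p : ℂ → ℝ) (v a : ℂ → ℂ) (w b : ℂ → ℝ) (γ : ℝ) (ζ₀ : ℂ), ContDiff ℝ 1 p → ContDiff ℝ 1 v →
      Continuous a → Continuous w → Continuous b →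
      (∀ z h : ℂ, fderiv ℝ p z h =
        ⟪-((1 - γ) • v z) - fderiv ℝ v z (γ • (z + ζ₀) + v z) - w z • a z, h⟫) →
      (∀ z : ℂ, (fderiv ℝ v z 1).re + (fderiv ℝ v z Complex.I).im = - b z) →
      ∀ (δ d : ℝ), 0 < δ → δ ≤ d →
        (Real.circleAverage p 0 δ + Real.circleAverage (fun z : ℂ => ⟪v z, (‖z‖⁻¹ : ℝ) • z⟫ ^ 2) 0 δ) -
            (Real.circleAverage p 0 d + Real.circleAverage (fun z : ℂ => ⟪v z, (‖z‖⁻¹ : ℝ) • z⟫ ^ 2) 0 d) =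
          (1 - 2 * γ) * ((2 * Real.pi)⁻¹ * (∫ ρ in δ..d, ∫ θ in (0 : ℝ)..2 * Real.pi,
              ⟪v (circleMap 0 ρ θ), circleMap 0 1 θ⟫)) +
            γ * (d * Real.circleAverage (fun z : ℂ => ⟪v z, (‖z‖⁻¹ : ℝ) • z⟫) 0 d -
                δ * Real.circleAverage (fun z : ℂ => ⟪v z, (‖z‖⁻¹ : ℝ) • z⟫) 0 δ) +
            (2 * Real.pi)⁻¹ * (∫ ρ in δ..d, ∫ θ in (0 : ℝ)..2 * Real.pi,
              w (circleMap 0 ρ θ) * ⟪a (circleMap 0 ρ θ), circleMap 0 1 θ⟫) +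
            γ * ((2 * Real.pi)⁻¹ * (∫ ρ in δ..d, ∫ θ in (0 : ℝ)..2 * Real.pi,
              ⟪fderiv ℝ v (circleMap 0 ρ θ) ζ₀, circleMap 0 1 θ⟫)) +
            (2 * Real.pi)⁻¹ * (∫ ρ in δ..d, ∫ θ in (0 : ℝ)..2 * Real.pi,
              ⟪v (circleMap 0 ρ θ), circleMap 0 1 θ⟫ * b (circleMap 0 ρ θ)) +
            (2 * Real.pi)⁻¹ * (∫ ρ in δ..d, ρ⁻¹ * ∫ θ in (0 : ℝ)..2 * Real.pi,
              (⟪v (circleMap 0 ρ θ), circleMap 0 1 θ⟫ ^ 2 -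
                ⟪v (circleMap 0 ρ θ), circleMap 0 1 θ * Complex.I⟫ ^ 2)) :=
  fun _ _ _ _ _ _ _ hp hv ha hw hb hpeq hdiv _ _ hδ hδd => sliceRadialMomentumIdentity_of hp hv ha hw hb hpeq hdiv hδ hδd

end Summit.NavierStokesRegularity.NavierStokesRegularity.Theorems.PowerGaugeEulerLiouville.Condenser

end
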